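import Literature.AlgebraicGeometry.FundamentalGroup.HypersurfaceComplementPencilDiscriminantShift
import Mathlib.RingTheory.MvPolynomial.EulerIdentity
import Mathlib.Algebra.Polynomial.Degree.SmallDegree
import HarnessLib

/-!
# The pencil discriminant for a HOMOGENEOUS polynomial: lines in the affine cone over a projective
# line transversal to a projective hypersurface

Topic `Literature/AlgebraicGeometry/FundamentalGroup`.  For a homogeneous `F ∈ ℂ[x₀, …, x_r]` of degree `d`
(a projective hypersurface `𝒴 = V(F) ⊂ ℙʳ`; its affine cone complement `ℂ^{r+1} ∖ V(F)` is an affine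
hypersurface complement to which the pencil theory of `HypersurfaceComplementPencilDiscriminant` /
`…ZariskiPencils` applies):

* §1 the restriction of `F` to an affine line `c ↦ b + c v` of `ℂ^{r+1}` has degree `≤ d` with top coefficient
  `F(v)` (`natDegree_linePoly_le_of_isHomogeneous`, `coeff_linePoly_of_isHomogeneous` — expansion in
  monomials), hence `deg_X lineRestr₂ F = d` and the leading-coefficient factor of `pencilDiscr F` at `(b, v)`
  is `F(v)` (`eval_leadingCoeff_lineRestr₂_of_isHomogeneous`);
* §2 Voisin's transversality hypothesis of Thm. 3.22 for the projective line `ℙ(P)`, `P = span(e, v)` — at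
  every zero `w ∈ P ∖ 0` of `F` the differential `dF(w)` does not vanish on `P` — gives, by Euler's identity
  (Mathlib `IsHomogeneous.sum_X_mul_pderiv`), that every root of `c ↦ F(e + c v)` is simple
  (`lineGood_of_transversal`);
* §3 hence **`pencilDiscr F (e, v) ≠ 0`** for `F(e) ≠ 0`, `F(v) ≠ 0` and `ℙ(span(e, v))` transversal to `V(F)`
  (`eval_pencilDiscr_ne_zero_of_transversal`), and a suitable `v` exists in every plane `P ∋ e` of
  dimension two (`exists_direction_of_transversal`): the input of Zariski's theorem on the cone.

Everything is proved; no definitions, no named facts.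

## References

* C. Voisin, *Hodge Theory and Complex Algebraic Geometry II*, CUP (2003), §3.2.2 Thm. 3.22 (the hypothesis
  "`Δ` meets `𝒴` transversally in its smooth locus"). [VoisinHodgeII2003]
* A. Dimca, *Singularities and Topology of Hypersurfaces* (1992), Ch. 4 §3 Prop. (3.1) and §1 (1.13) (the cone
  `ℂⁿ⁺¹ ∖ f⁻¹(0)` over `ℙⁿ ∖ V`). [Dimca1992]
-/

noncomputable section

open MvPolynomial Set
open scoped Polynomial

namespace Literature.AlgebraicGeometry.FundamentalGroup

variable {ι : Type}

/-! ### §1 Degree and top coefficient of the restriction of a homogeneous polynomial to a line -/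

section Homogeneous

/-- The restriction of a monomial to a line: `(b + Xv)^m = ∏ᵢ (bᵢ + vᵢ X)^{mᵢ}` times the coefficient.
[cite: Dimca1992, Ch. 4 §1 (1.13)] -/
theorem linePoly_monomial (m : ι →₀ ℕ) (a : ℂ) (b v : ι → ℂ) :
    linePoly (monomial m a) b v = Polynomial.C a * m.prod fun i e => (Polynomial.C (b i) + Polynomial.C (v i) * Polynomial.X) ^ e := by
  rw [linePoly, lineRestr₂, MvPolynomial.aeval_monomial, Polynomial.map_mul, Polynomial.algebraMap_apply,
    MvPolynomial.algebraMap_eq, Polynomial.map_C, MvPolynomial.eval_C, Finsupp.prod, Finsupp.prod,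
    Polynomial.map_prod]
  congr 1
  refine Finset.prod_congr rfl fun i _ => ?_
  rw [Polynomial.map_pow, Polynomial.map_add, Polynomial.map_mul, Polynomial.map_C, Polynomial.map_C,
    Polynomial.map_X, MvPolynomial.eval_X, MvPolynomial.eval_X, Sum.elim_inl, Sum.elim_inr]

/-- A product of powers of linear polynomials `(βᵢ + αᵢ X)^{mᵢ}` has degree `≤ Σ mᵢ` and its coefficient in that
degree is `∏ αᵢ^{mᵢ}`. [folklore] -/
private theorem natDegree_prod_linear_pow_le_and_coeff (s : Finset ι) (m : ι → ℕ) (β α : ι → ℂ) :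
    (∏ i ∈ s, (Polynomial.C (β i) + Polynomial.C (α i) * Polynomial.X) ^ m i).natDegree ≤ ∑ i ∈ s, m i ∧
      (∏ i ∈ s, (Polynomial.C (β i) + Polynomial.C (α i) * Polynomial.X) ^ m i).coeff (∑ i ∈ s, m i) =
        ∏ i ∈ s, α i ^ m i := by
  classical
  have h1 : ∀ i, (Polynomial.C (β i) + Polynomial.C (α i) * Polynomial.X).natDegree ≤ 1 := fun i => by
    rw [add_comm]; exact Polynomial.natDegree_linear_le
  have hc1 : ∀ i, (Polynomial.C (β i) + Polynomial.C (α i) * Polynomial.X).coeff 1 = α i := fun i => by simp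
  have hpow : ∀ i, ((Polynomial.C (β i) + Polynomial.C (α i) * Polynomial.X) ^ m i).natDegree ≤ m i ∧
      ((Polynomial.C (β i) + Polynomial.C (α i) * Polynomial.X) ^ m i).coeff (m i) = α i ^ m i := fun i => by
    refine ⟨Polynomial.natDegree_pow_le.trans (by simpa using Nat.mul_le_mul_left (m i) (h1 i)), ?_⟩
    have := Polynomial.coeff_pow_of_natDegree_le (m := m i) (h1 i)
    rw [mul_one] at this
    rw [this, hc1]
  induction s using Finset.induction_on with
  | empty => simp
  | insert i s hi ih =>
    rw [Finset.prod_insert hi, Finset.sum_insert hi, Finset.prod_insert hi]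
    refine ⟨(Polynomial.natDegree_mul_le).trans (add_le_add (hpow i).1 ih.1), ?_⟩
    rw [Polynomial.coeff_mul_add_eq_of_natDegree_le (hpow i).1 ih.1, (hpow i).2, ih.2]

/-- **The restriction of a homogeneous polynomial of degree `d` to a line has degree `≤ d`.**
[cite: Dimca1992, Ch. 4 §1 (1.13)] -/
theorem natDegree_linePoly_le_of_isHomogeneous {F : MvPolynomial ι ℂ} {d : ℕ} (hF : F.IsHomogeneous d)
    (b v : ι → ℂ) : (linePoly F b v).natDegree ≤ d := by
  classical
  conv_lhs => rw [F.as_sum]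
  rw [linePoly, map_sum, Polynomial.map_sum]
  refine Polynomial.natDegree_sum_le_of_forall_le _ _ fun m hm => ?_
  change (linePoly (monomial m (coeff m F)) b v).natDegree ≤ d
  rw [linePoly_monomial, Finsupp.prod]
  have hdeg : ∑ i ∈ m.support, m i = d := by
    have h := hF (mem_support_iff.1 hm)
    rw [Finsupp.weight_apply] at h
    simpa [Finsupp.sum] using h
  refine (Polynomial.natDegree_C_mul_le _ _).trans ?_
  rw [← hdeg]
  exact (natDegree_prod_linear_pow_le_and_coeff m.support m b v).1

/-- **Its coefficient in degree `d` is `F(v)`** (the value of `F` at the direction: the point at infinity of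
the line lies on `V(F)` iff the degree drops). [cite: Dimca1992, Ch. 4 §1 (1.13)] -/
theorem coeff_linePoly_of_isHomogeneous {F : MvPolynomial ι ℂ} {d : ℕ} (hF : F.IsHomogeneous d) (b v : ι → ℂ) :
    (linePoly F b v).coeff d = MvPolynomial.eval v F := by
  classical
  conv_lhs => rw [F.as_sum]
  conv_rhs => rw [F.as_sum]
  rw [linePoly, map_sum, Polynomial.map_sum, map_sum, Polynomial.finsetSum_coeff]
  refine Finset.sum_congr rfl fun m hm => ?_
  change (linePoly (monomial m (coeff m F)) b v).coeff d = _
  have hdeg : ∑ i ∈ m.support, m i = d := by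
    have h := hF (mem_support_iff.1 hm)
    rw [Finsupp.weight_apply] at h
    simpa [Finsupp.sum] using h
  rw [linePoly_monomial, Polynomial.coeff_C_mul, MvPolynomial.eval_monomial, Finsupp.prod, Finsupp.prod, ← hdeg,
    (natDegree_prod_linear_pow_le_and_coeff m.support m b v).2]

/-- **For a non-zero homogeneous `F` of degree `d`, `deg_X lineRestr₂ F = d`.** [cite: Dimca1992, Ch. 4 §1 (1.13)] -/
theorem natDegree_lineRestr₂_of_isHomogeneous {F : MvPolynomial ι ℂ} {d : ℕ} (hF : F.IsHomogeneous d) (hF0 : F ≠ 0) :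
    (lineRestr₂ F).natDegree = d := by
  classical
  -- some direction with `F(v) ≠ 0`, some base point: the restriction has degree exactly `d`
  obtain ⟨v, hv⟩ : ∃ v : ι → ℂ, MvPolynomial.eval v F ≠ 0 := by
    by_contra h; push Not at h
    exact hF0 (MvPolynomial.funext fun x => by rw [h x, map_zero])
  apply le_antisymm
  · -- the leading coefficient is a non-zero polynomial in `(b, v)`; where it does not vanish, `N ≤ deg ≤ d`
    have hlc : (lineRestr₂ F).leadingCoeff ≠ 0 := by
      rw [Ne, Polynomial.leadingCoeff_eq_zero]
      intro h0
      apply hv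
      have := eval_linePoly F v v 0
      rw [linePoly, h0, Polynomial.map_zero, Polynomial.eval_zero, zero_smul, add_zero] at this
      exact this.symm
    obtain ⟨w, hw⟩ : ∃ w : ι ⊕ ι → ℂ, MvPolynomial.eval w (lineRestr₂ F).leadingCoeff ≠ 0 := by
      by_contra h; push Not at h
      exact hlc (MvPolynomial.funext fun x => by rw [h x, map_zero])
    have hw' : Sum.elim (w ∘ Sum.inl) (w ∘ Sum.inr) = w := by ext i; rcases i with i | i <;> rfl
    rw [← hw', eval_leadingCoeff_lineRestr₂] at hw
    exact (Polynomial.le_natDegree_of_ne_zero hw).trans (natDegree_linePoly_le_of_isHomogeneous hF _ _)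
  · have h := coeff_linePoly_of_isHomogeneous hF v v
    rw [← h] at hv
    exact (Polynomial.le_natDegree_of_ne_zero hv).trans (natDegree_linePoly_le _ _ _)

/-- **The leading-coefficient factor of `pencilDiscr F` at `(b, v)` is `F(v)`** for homogeneous `F ≠ 0`.
[cite: Dimca1992, Ch. 4 §1 (1.13)] -/
theorem eval_leadingCoeff_lineRestr₂_of_isHomogeneous {F : MvPolynomial ι ℂ} {d : ℕ} (hF : F.IsHomogeneous d)
    (hF0 : F ≠ 0) (b v : ι → ℂ) :
    MvPolynomial.eval (Sum.elim b v) (lineRestr₂ F).leadingCoeff = MvPolynomial.eval v F := by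
  rw [eval_leadingCoeff_lineRestr₂, natDegree_lineRestr₂_of_isHomogeneous hF hF0, coeff_linePoly_of_isHomogeneous hF]

end Homogeneous

/-! ### §2 Transversality of a projective line and simple roots (Euler's identity) -/

section Transversal

variable [Fintype ι] {F : MvPolynomial ι ℂ} {d : ℕ}

/-- Euler's identity evaluated: `Σᵢ wᵢ ∂ᵢF(w) = d · F(w)` for `F` homogeneous of degree `d`.
[cite: VoisinHodgeII2003, §3.2.2 (proof of Thm. 3.22)] -/
theorem sum_mul_eval_pderiv_of_isHomogeneous (hF : F.IsHomogeneous d) (w : ι → ℂ) :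
    ∑ i, w i * MvPolynomial.eval w (pderiv i F) = d * MvPolynomial.eval w F := by
  have h := congrArg (MvPolynomial.eval w) hF.sum_X_mul_pderiv
  rw [map_sum, map_nsmul, nsmul_eq_mul] at h
  simpa only [map_mul, MvPolynomial.eval_X] using h

/-- **Transversality of `ℙ(span(e, v))` to `V(F)` forces simple roots on the affine line `e + ℂ v`.**  If at
every zero `w ≠ 0` of `F` in `P = {α e + β v}` some vector of `P` is not killed by `dF(w)`, then at every root
`c` of `c ↦ F(e + c v)` with `e + c v ≠ 0` one has `Σᵢ ∂ᵢF(e + cv) vᵢ ≠ 0` (Euler: `dF(w)·w = d F(w) = 0`, so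
`dF(w)·e = −c dF(w)·v` and `dF(w)·(αe + βv) = (β − αc) dF(w)·v`). [cite: VoisinHodgeII2003, §3.2.2 Thm. 3.22 (hypothesis)] -/
theorem sum_eval_pderiv_mul_ne_zero_of_transversal (hF : F.IsHomogeneous d) {e v : ι → ℂ} {c : ℂ}
    (hw0 : MvPolynomial.eval (e + c • v) F = 0)
    (htr : ∃ α β : ℂ, ∑ i, MvPolynomial.eval (e + c • v) (pderiv i F) * (α • e + β • v) i ≠ 0) :
    ∑ i, MvPolynomial.eval (e + c • v) (pderiv i F) * v i ≠ 0 := by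
  obtain ⟨α, β, h⟩ := htr
  set w := e + c • v with hw
  set D : ι → ℂ := fun i => MvPolynomial.eval w (pderiv i F) with hD
  have heuler : ∑ i, D i * w i = 0 := by
    have h1 := sum_mul_eval_pderiv_of_isHomogeneous hF w
    rw [hw0, mul_zero] at h1
    rw [← h1]
    exact Finset.sum_congr rfl fun i _ => mul_comm _ _
  have he : ∑ i, D i * e i = -c * ∑ i, D i * v i := by
    have : ∑ i, D i * w i = ∑ i, D i * e i + c * ∑ i, D i * v i := by
      rw [Finset.mul_sum, ← Finset.sum_add_distrib]
      refine Finset.sum_congr rfl fun i _ => ?_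
      simp only [hw, Pi.add_apply, Pi.smul_apply, smul_eq_mul]; ring
    rw [this] at heuler
    linear_combination heuler
  have hsum : ∑ i, D i * (α • e + β • v) i = (β - α * c) * ∑ i, D i * v i := by
    have : ∑ i, D i * (α • e + β • v) i = α * ∑ i, D i * e i + β * ∑ i, D i * v i := by
      rw [Finset.mul_sum, Finset.mul_sum, ← Finset.sum_add_distrib]
      refine Finset.sum_congr rfl fun i _ => ?_
      simp only [Pi.add_apply, Pi.smul_apply, smul_eq_mul]; ring
    rw [this, he]; ring
  intro h0
  apply h
  change ∑ i, D i * (α • e + β • v) i = 0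
  rw [hsum, h0, mul_zero]

/-- **A transversal projective line gives a good affine line**: for `F` homogeneous, `e, v` and the transversality
hypothesis of Voisin's Thm. 3.22 on the span of `e, v` (in the form: at every root some `αe + βv` is not
killed by `dF`), the pointed line `(e, v)` is `LineGood ![F]` (all roots simple).
[cite: VoisinHodgeII2003, §3.2.2 Thm. 3.22 (hypothesis)] -/
theorem lineGood_of_transversal (hF : F.IsHomogeneous d) {e v : ι → ℂ}
    (htr : ∀ c : ℂ, MvPolynomial.eval (e + c • v) F = 0 →
      ∃ α β : ℂ, ∑ i, MvPolynomial.eval (e + c • v) (pderiv i F) * (α • e + β • v) i ≠ 0) :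
    LineGood ![F] e v := by
  intro j c hc
  fin_cases j
  refine ⟨sum_eval_pderiv_mul_ne_zero_of_transversal hF hc (htr c hc), fun i hi => ?_⟩
  exact absurd (Subsingleton.elim i 0) hi

end Transversal

/-! ### §3 The pencil discriminant on the cone -/

section Cone

variable [Fintype ι] {F : MvPolynomial ι ℂ} {d : ℕ}

/-- **`pencilDiscr F (e, v) ≠ 0` on the cone**: `F` homogeneous of degree `d`, `F(e) ≠ 0` (the base point is
off the cone over `V(F)`), `F(v) ≠ 0` (the point at infinity `[v]` of the line is off `V(F)`: the degree is
kept), and the transversality hypothesis along `e + ℂv`. [cite: VoisinHodgeII2003, §3.2.2 Thm. 3.22]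
[cite: Dimca1992, Ch. 4 §3 Prop. (3.1)] -/
theorem eval_pencilDiscr_ne_zero_of_transversal (hF : F.IsHomogeneous d) {e v : ι → ℂ}
    (he : MvPolynomial.eval e F ≠ 0) (hv : MvPolynomial.eval v F ≠ 0)
    (htr : ∀ c : ℂ, MvPolynomial.eval (e + c • v) F = 0 →
      ∃ α β : ℂ, ∑ i, MvPolynomial.eval (e + c • v) (pderiv i F) * (α • e + β • v) i ≠ 0) :
    MvPolynomial.eval (Sum.elim e v) (pencilDiscr F) ≠ 0 := by
  have hF0 : F ≠ 0 := fun h => he (by rw [h, map_zero])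
  refine eval_pencilDiscr_ne_zero he ?_ ?_
  · rw [eval_leadingCoeff_lineRestr₂_of_isHomogeneous hF hF0]; exact hv
  · exact separable_linePoly_of_lineGood (lineGood_of_transversal hF htr)

omit [Fintype ι] in
/-- In a `2`-dimensional space, two vectors `e ≠ 0`, `v ∉ ℂe` span: every `p` is `αe + βv`. [folklore] -/
private theorem exists_pair_repr {P : Submodule ℂ (ι → ℂ)} (hP : Module.finrank ℂ P = 2) {e v : ι → ℂ}
    (he : e ∈ P) (hv : v ∈ P) (he0 : e ≠ 0) (hve : v ∉ Submodule.span ℂ {e}) (p : ι → ℂ) (hp : p ∈ P) :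
    ∃ α β : ℂ, α • e + β • v = p := by
  let e' : P := ⟨e, he⟩
  let v' : P := ⟨v, hv⟩
  have hli : LinearIndependent ℂ ![e', v'] := by
    rw [LinearIndependent.pair_iff]
    intro s t hst
    have hst' : s • e + t • v = 0 := by
      have := congrArg Subtype.val hst
      simpa [e', v'] using this
    by_cases ht : t = 0
    · subst ht
      rw [zero_smul, add_zero] at hst'
      exact ⟨(smul_eq_zero.1 hst').resolve_right he0, rfl⟩
    · exfalso
      apply hve
      rw [Submodule.mem_span_singleton]
      refine ⟨-(t⁻¹ * s), ?_⟩
      have : t • v = -(s • e) := eq_neg_of_add_eq_zero_right hst'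
      calc -(t⁻¹ * s) • e = t⁻¹ • (-(s • e)) := by rw [smul_neg, ← mul_smul, neg_smul]
        _ = t⁻¹ • (t • v) := by rw [this]
        _ = v := by rw [← mul_smul, inv_mul_cancel₀ ht, one_smul]
  have hspan := hli.span_eq_top_of_card_eq_finrank (by rw [hP]; rfl)
  have hp' : (⟨p, hp⟩ : P) ∈ Submodule.span ℂ (Set.range ![e', v']) := by rw [hspan]; exact Submodule.mem_top
  rw [Matrix.range_cons_cons_empty, Submodule.mem_span_pair] at hp'
  obtain ⟨α, β, h⟩ := hp'
  refine ⟨α, β, ?_⟩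
  have := congrArg Subtype.val h
  simpa [e', v'] using this

omit [Fintype ι] in
/-- **A good direction in a transversal plane.**  `F` homogeneous of degree `d`, `P` a plane (`finrank 2`),
`e ∈ P` with `e ≠ 0`, `F(e) ≠ 0`: there is `v ∈ P` with `F(v) ≠ 0`, `e + cv ≠ 0` for all `c`, and
`P = {αe + βv}` — so the affine line `e + ℂv` of the cone maps onto `ℙ(P)` minus one point, and Voisin's
transversality hypothesis for `ℙ(P)` becomes the hypothesis of `eval_pencilDiscr_ne_zero_of_transversal`.
(Choose `w ∈ P ∖ ℂe` and `v = w + λe` off the finitely many roots of `λ ↦ F(w + λe)`, whose top coefficient is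
`F(e) ≠ 0`.) [cite: VoisinHodgeII2003, §3.2.2 Thm. 3.22 (proof: the set `W` of good lines)] -/
theorem exists_direction_of_transversal (hF : F.IsHomogeneous d) {P : Submodule ℂ (ι → ℂ)}
    (hP : Module.finrank ℂ P = 2) {e : ι → ℂ} (he : e ∈ P) (he0 : e ≠ 0) (hFe : MvPolynomial.eval e F ≠ 0) :
    ∃ v ∈ P, MvPolynomial.eval v F ≠ 0 ∧ (∀ c : ℂ, e + c • v ≠ 0) ∧ ∀ p ∈ P, ∃ α β : ℂ, α • e + β • v = p := by
  classical
  -- a second vector of the plane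
  have hlt : Submodule.span ℂ {e} < P := by
    refine lt_of_le_of_ne ((Submodule.span_singleton_le_iff_mem e P).2 he) fun h => ?_
    have h1 := finrank_span_singleton (K := ℂ) he0
    rw [h, hP] at h1
    exact absurd h1 (by norm_num)
  obtain ⟨w, hwP, hwe⟩ := SetLike.exists_of_lt hlt
  -- `λ ↦ F(w + λ e)` is a non-zero polynomial (top coefficient `F(e)`): pick `λ` off its roots
  have hne : linePoly F w e ≠ 0 := by
    intro h0
    have := coeff_linePoly_of_isHomogeneous hF w e
    rw [h0, Polynomial.coeff_zero] at this
    exact hFe this.symm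
  obtain ⟨l, hl⟩ := Infinite.exists_notMem_finset (linePoly F w e).roots.toFinset
  have hlroot : MvPolynomial.eval (w + l • e) F ≠ 0 := by
    intro h0
    apply hl
    rw [Multiset.mem_toFinset, Polynomial.mem_roots hne, Polynomial.IsRoot.def, eval_linePoly]
    exact h0
  refine ⟨w + l • e, P.add_mem hwP (P.smul_mem l he), hlroot, fun c hc => ?_, ?_⟩
  · -- `e + c (w + l e) = (1 + c l) e + c w = 0` forces `c w ∈ ℂ e`
    by_cases hc0 : c = 0
    · subst hc0; rw [zero_smul, add_zero] at hc; exact he0 hc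
    · apply hwe
      rw [Submodule.mem_span_singleton]
      refine ⟨-(c⁻¹ * (1 + c * l)), ?_⟩
      have h1 : c • w = -((1 + c * l) • e) := by
        have : e + c • (w + l • e) = (1 + c * l) • e + c • w := by
          rw [smul_add, ← mul_smul, add_smul, one_smul]; abel
        rw [this] at hc
        exact eq_neg_of_add_eq_zero_right hc
      calc -(c⁻¹ * (1 + c * l)) • e = c⁻¹ • (-((1 + c * l) • e)) := by rw [smul_neg, ← mul_smul, neg_smul]
        _ = c⁻¹ • (c • w) := by rw [h1]
        _ = w := by rw [← mul_smul, inv_mul_cancel₀ hc0, one_smul]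
  · have hve : w + l • e ∉ Submodule.span ℂ {e} := fun h =>
      hwe (by simpa using (Submodule.span ℂ {e}).sub_mem h ((Submodule.span ℂ {e}).smul_mem l (Submodule.mem_span_singleton_self e)))
    exact exists_pair_repr hP he (P.add_mem hwP (P.smul_mem l he)) he0 hve

end Cone

end Literature.AlgebraicGeometry.FundamentalGroup

end
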